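import Summits.AtomisticToContinuum.Crystallization.Theorems.ThreeConeCertificateSlackRigidityLayeringLayers

/-!
# Line `c-layer-witness-strictness` (crux `SlackRigidity`, stmt-AtomisticToContinuum-11960):
# layering off the ideal ratio — part 4/4, the stub `stub_layeringOffIdeal`

Stub `stub_layeringOffIdeal` (registered obligation of the line skeleton), part 4: a set `Y ∋ 0`
in `ℝ³` every point of which sees, inside the closed ball of radius `6a/5` about it, EXACTLY a
linearly rotated 13-point Barlow star with the spacings `(a, h)` of the window
`0.775 a < h < 0.894 a`, OFF the ideal ratio `h² ≠ 2a²/3`, is ONE linearly rotated Barlow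
stacking through `0`.  Proof: WLOG the star of `0` is standard (conjugate by the rotation `B₀`
of the star of `0`, upgraded to a linear isometry equivalence in finite dimension); then
`u, v ∈ Y`, the layer `ℤu + ℤv ⊆ Y` (`layer_subset_of_two_neighbours`), all layers
`barlowStacking a h s ⊆ Y` (`layeringLayers_exists_barlowStacking_subset`), and conversely every
`z ∈ Y` lies within `6a/5` of a stacking point `p` (`exists_dist_barlowPos_le`, rounding), hence
in the star of `p`, which is the standard star with the classes `(s k, −s(k−1))` of the stacking
(read off the adjacent layers, `sign_eq_of_vecE_add_mem_std`), i.e. `z` is a point of the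
re-rooted stacking `barlowStacking a h (s (· + k)) + p ⊆ barlowStacking a h s`
(`barlowPos_shift_add`).  All `[folklore]` (Hales, *Dense Sphere Packings* §1.3 at general
`(a, h)` with exact stars).
-/

noncomputable section

namespace Summit.AtomisticToContinuum.Crystallization.Theorems.CLayerWitnessLayering

open Literature.MathematicalPhysics.StatisticalMechanics RealInnerProductSpace

/-- Euclidean `3`-space. -/
local notation "E3" => EuclideanSpace ℝ (Fin 3)
set_option hygiene false in
/-- First in-layer generator `u = (a, 0, 0)` (the ambient `a`). -/
local notation "𝐮" => triangularVec₁ a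
set_option hygiene false in
/-- Second in-layer generator `v = (a/2, a√3/2, 0)`. -/
local notation "𝐯" => triangularVec₂ a
set_option hygiene false in
/-- The hole offset `w = (u + v)/3`. -/
local notation "𝐰" => barlowOffset a
set_option hygiene false in
/-- The interlayer vector `h e₃` (the ambient `h`). -/
local notation "𝐞" => layerNormal h
set_option hygiene false in
/-- The standard hexagon `H = {u, v, −u, −v, u − v, v − u}`. -/
local notation "Hex" => ({triangularVec₁ a, triangularVec₂ a, -triangularVec₁ a, -triangularVec₂ a,
    triangularVec₁ a - triangularVec₂ a, triangularVec₂ a - triangularVec₁ a} :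
      Set (EuclideanSpace ℝ (Fin 3)))

variable {a h : ℝ}

/-! ## Re-rooting a stacking -/

/-- Labels of the re-rooted Hägg sequence `s (· + k)`: `L' n = L (n + k) − L k`. [folklore] -/
theorem haggLabel_shift (s : ℤ → ℤ) (k n : ℤ) :
    haggLabel (fun m => s (m + k)) n = haggLabel s (n + k) - haggLabel s k := by
  induction n using Int.induction_on with
  | zero => rw [zero_add, haggLabel_zero, sub_self]
  | succ n ih =>
    rw [haggLabel_succ, ih, show (n : ℤ) + 1 + k = n + k + 1 by ring, haggLabel_succ]; ring
  | pred n ih =>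
    have h1 := haggLabel_succ (fun m => s (m + k)) (-(n : ℤ) - 1)
    have h2 := haggLabel_succ s (-(n : ℤ) - 1 + k)
    rw [show -(n : ℤ) - 1 + 1 = -n by ring] at h1
    rw [show -(n : ℤ) - 1 + k + 1 = -n + k by ring] at h2
    linarith

/-- **Re-rooting**: the stacking of `s (· + k)` translated by the point `(k, i, j)` of the
stacking of `s` lies in the stacking of `s`. [folklore] -/
theorem barlowPos_shift_add (s : ℤ → ℤ) (k i j k' i' j' : ℤ) :
    barlowPos a h (fun m => s (m + k)) k' i' j' + barlowPos a h s k i j =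
      barlowPos a h s (k' + k) (i' + i) (j' + j) := by
  simp only [barlowPos, haggLabel_shift]
  push_cast
  module

/-! ## Covering: every point of space is within `6a/5` of the stacking -/

/-- **Rounding**: every point of `ℝ³` is within `6a/5` of `barlowStacking a h s` (squared
distance `≤ 7a²/16 + h²/4 < 0.64 a²` by rounding the three coordinates in turn). [folklore] -/
theorem exists_dist_barlowPos_le (ha : 0 < a) (hh : 0 < h) (hw2 : h < 0.894 * a) (s : ℤ → ℤ)
    (z : E3) : ∃ k i j : ℤ, dist z (barlowPos a h s k i j) ≤ 6 * a / 5 := by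
  have hs3 : Real.sqrt 3 ^ 2 = 3 := sqrt_three_sq'
  have h3 : Real.sqrt 3 ≠ 0 := by positivity
  set k : ℤ := round (z 2 / h) with hk
  set L : ℝ := (haggLabel s k : ℝ) with hL
  set jr : ℝ := z 1 / (a * Real.sqrt 3 / 2) - L / 3 with hjr
  set j : ℤ := round jr with hj
  set ir : ℝ := z 0 / a - j / 2 - L / 2 with hir
  set i : ℤ := round ir with hi
  refine ⟨k, i, j, ?_⟩
  have e2 : (z 2 / h - k) ^ 2 ≤ 1 / 4 := by
    have hb := abs_sub_round (z 2 / h)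
    rw [← hk] at hb
    rw [← sq_abs]; nlinarith [abs_nonneg (z 2 / h - k)]
  have e1 : (jr - j) ^ 2 ≤ 1 / 4 := by
    have hb := abs_sub_round jr
    rw [← hj] at hb
    rw [← sq_abs]; nlinarith [abs_nonneg (jr - j)]
  have e0 : (ir - i) ^ 2 ≤ 1 / 4 := by
    have hb := abs_sub_round ir
    rw [← hi] at hb
    rw [← sq_abs]; nlinarith [abs_nonneg (ir - i)]
  have d2 : z 2 - k * h = h * (z 2 / h - k) := by field_simp
  have d1 : z 1 - a * Real.sqrt 3 / 2 * (j + L / 3) = (a * Real.sqrt 3 / 2) * (jr - j) := by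
    rw [hjr]; field_simp; ring
  have d0 : z 0 - a * (i + j / 2 + L / 2) = a * (ir - i) := by
    rw [hir]; field_simp; ring
  have hsq : dist z (barlowPos a h s k i j) ^ 2 ≤ (6 * a / 5) ^ 2 := by
    rw [dist_sq_fin3, barlowPos_apply_zero, barlowPos_apply_one, barlowPos_apply_two, ← hL, d0, d1,
      d2]
    have t1 : (a * Real.sqrt 3 / 2 * (jr - j)) ^ 2 = 3 / 4 * (a ^ 2 * (jr - j) ^ 2) := by
      linear_combination (a ^ 2 * (jr - j) ^ 2 / 4) * hs3
    rw [mul_pow, t1, mul_pow]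
    have b0 := mul_le_mul_of_nonneg_left e0 (sq_nonneg a)
    have b1 := mul_le_mul_of_nonneg_left e1 (sq_nonneg a)
    have b2 := mul_le_mul_of_nonneg_left e2 (sq_nonneg h)
    have hh2 : h ^ 2 < 0.8 * a ^ 2 := by nlinarith
    nlinarith
  exact (pow_le_pow_iff_left₀ dist_nonneg (by positivity) two_ne_zero).1 hsq

/-! ## The stacking exhausts `Y` -/

/-- **In the frame, `Y` IS the stacking**: under the star hypothesis (window, off-ideal), if
`ℤu + ℤv ⊆ Y` then `Y = barlowStacking a h s` for a Hägg sequence `s`. [folklore] -/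
theorem eq_barlowStacking_of_stars (ha : 0 < a) (hh : 0 < h) (hw1 : 0.775 * a < h)
    (hw2 : h < 0.894 * a) (hoff : h ^ 2 ≠ 2 * a ^ 2 / 3) {Y : Set E3}
    (hloc : ∀ y ∈ Y, ∃ s : ℤ → ℤ, IsHaggSeq s ∧ ∃ B : E3 →ₗᵢ[ℝ] E3,
      ((fun z => z - y) '' Y) ∩ Metric.closedBall 0 (6 * a / 5) =
        B '' (barlowStacking a h s ∩ Metric.closedBall 0 (6 * a / 5)))
    (h0 : ∀ i j : ℤ, (i : ℝ) • (𝐮 : E3) + (j : ℝ) • 𝐯 ∈ Y) :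
    ∃ s : ℤ → ℤ, IsHaggSeq s ∧ Y = barlowStacking a h s := by
  obtain ⟨s, hs, hsub⟩ := layeringLayers_exists_barlowStacking_subset ha hh hw1 hw2 hoff hloc h0
  refine ⟨s, hs, Set.Subset.antisymm (fun z hz => ?_) hsub⟩
  obtain ⟨k, i, j, hd⟩ := exists_dist_barlowPos_le ha hh hw2 s z
  set p := barlowPos a h s k i j with hp_def
  have hp : p ∈ Y := hsub (barlowPos_mem k i j)
  have hpu : p + 𝐮 ∈ Y := by
    convert hsub (barlowPos_mem k (i + 1) j) using 1
    simp only [hp_def, barlowPos]; push_cast; module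
  have hpv : p + 𝐯 ∈ Y := by
    convert hsub (barlowPos_mem k i (j + 1)) using 1
    simp only [hp_def, barlowPos]; push_cast; module
  obtain ⟨s', hs', B, hstar⟩ := hloc p hp
  obtain ⟨τ₁, τ₂, hτ₁, hτ₂, hstd⟩ := std_of_two_neighbours ha hh hw1 hw2 hoff hs' hstar
    vecU_mem_hex vecV_mem_hex (dist_vecU_vecV ha.le) hpu hpv
  have hb := third_add_sq_le ha hh hw2
  have hball : ∀ x : E3, ⟪x, x⟫ ≤ (6 * a / 5) ^ 2 → x ∈ Metric.closedBall (0 : E3) (6 * a / 5) := by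
    intro x hx
    rw [Metric.mem_closedBall, dist_zero_right]
    rw [real_inner_self_eq_norm_sq] at hx
    exact (pow_le_pow_iff_left₀ (norm_nonneg _) (by positivity) two_ne_zero).1 hx
  -- the classes of the star of `p` are those of the stacking
  have hσ₁ : ((s k : ℤ) : ℝ) = 1 ∨ ((s k : ℤ) : ℝ) = -1 := by
    rcases hs k with h1 | h1 <;> simp [h1]
  have hσ₂ : (-((s (k - 1) : ℤ) : ℝ)) = 1 ∨ (-((s (k - 1) : ℤ) : ℝ)) = -1 := by
    rcases hs (k - 1) with h1 | h1 <;> simp [h1]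
  have hw : (𝐰 : E3) ∈ ({𝐰, 𝐰 - 𝐮, 𝐰 - 𝐯} : Set E3) := Set.mem_insert _ _
  have hup : (𝐞 : E3) + ((s k : ℤ) : ℝ) • 𝐰 ∈
      ((fun z => z - p) '' Y) ∩ Metric.closedBall 0 (6 * a / 5) := by
    refine ⟨⟨barlowPos a h s (k + 1) i j, hsub (barlowPos_mem _ _ _), ?_⟩,
      hball _ (by rw [inner_self_vecE_add_smul hσ₁ hw]; exact hb)⟩
    simp only [hp_def, barlowPos, haggLabel_succ]; push_cast; module
  have hdn : -(𝐞 : E3) + (-((s (k - 1) : ℤ) : ℝ)) • 𝐰 ∈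
      ((fun z => z - p) '' Y) ∩ Metric.closedBall 0 (6 * a / 5) := by
    refine ⟨⟨barlowPos a h s (k - 1) i j, hsub (barlowPos_mem _ _ _), ?_⟩,
      hball _ (by rw [inner_self_neg_vecE_add_smul hσ₂ hw]; exact hb)⟩
    have hL : haggLabel s k = haggLabel s (k - 1) + s (k - 1) := by
      have := haggLabel_succ s (k - 1); rwa [sub_add_cancel] at this
    simp only [hp_def, barlowPos, hL]; push_cast; module
  rw [hstd] at hup hdn
  have hτ₁' : ((s k : ℤ) : ℝ) = τ₁ := sign_eq_of_vecE_add_mem_std ha hh hσ₁ hτ₁ hτ₂ hup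
  have hτ₂' : (-((s (k - 1) : ℤ) : ℝ)) = τ₂ := sign_eq_of_neg_vecE_add_mem_std ha hh hσ₂ hτ₁ hτ₂ hdn
  -- `z` is in the star of `p`, which is the star of the re-rooted stacking
  have hz' : z - p ∈ ((fun z => z - p) '' Y) ∩ Metric.closedBall 0 (6 * a / 5) := by
    refine ⟨⟨z, hz, rfl⟩, ?_⟩
    rwa [Metric.mem_closedBall, dist_zero_right, ← dist_eq_norm]
  have hshift : IsHaggSeq (fun m => s (m + k)) := fun m => hs (m + k)
  have hS := layeringStar_stacking_inter_closedBall ha hh hw1 hw2 hshift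
  simp only [zero_add, show (-1 : ℤ) + k = k - 1 by ring] at hS
  rw [hstd, ← hτ₁', ← hτ₂', ← hS] at hz'
  obtain ⟨⟨k', i', j', hk'⟩, -⟩ := hz'
  refine ⟨k' + k, i' + i, j' + j, ?_⟩
  rw [← barlowPos_shift_add, ← hk', sub_add_cancel]

/-! ## The stub -/

/-- **Conjugating the star hypothesis** by a linear isometry equivalence `T`: the stars of
`T '' Y` are the `T`-images of the stars of `Y`. [folklore] -/
theorem star_image_equiv (T : E3 ≃ₗᵢ[ℝ] E3) (Y : Set E3) (y : E3) (r : ℝ) :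
    ((fun z => z - T y) '' (T '' Y)) ∩ Metric.closedBall 0 r =
      T '' (((fun z => z - y) '' Y) ∩ Metric.closedBall 0 r) := by
  have hball : T '' Metric.closedBall (0 : E3) r = Metric.closedBall 0 r := by
    rw [LinearIsometryEquiv.image_closedBall, map_zero]
  have h1 : (fun z => z - T y) '' (T '' Y) = T '' ((fun z => z - y) '' Y) := by
    simp only [Set.image_image, map_sub]
  rw [h1, Set.image_inter T.injective, hball]

/-- **Stub `stub_layeringOffIdeal` — layering OFF the ideal ratio**: exact Barlow 13-stars
everywhere (window `0.775 a < h < 0.894 a`, `h² ≠ 2a²/3`) ⇒ `Y` is one linearly rotated Barlow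
stacking through `0`. [folklore] -/
theorem stub_layeringOffIdeal :
    ∀ (a h : ℝ), 0 < a → 0 < h → 0.775 * a < h → h < 0.894 * a → h ^ 2 ≠ 2 * a ^ 2 / 3 →
    ∀ Y : Set E3, (0 : E3) ∈ Y →
      (∀ y ∈ Y, ∃ s : ℤ → ℤ, IsHaggSeq s ∧ ∃ B : E3 →ₗᵢ[ℝ] E3,
        ((fun z => z - y) '' Y) ∩ Metric.closedBall 0 (6 * a / 5) =
          B '' (barlowStacking a h s ∩ Metric.closedBall 0 (6 * a / 5))) →
      ∃ s : ℤ → ℤ, IsHaggSeq s ∧ ∃ A : E3 →ₗᵢ[ℝ] E3, Y = A '' barlowStacking a h s := by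
  intro a h ha hh hw1 hw2 hoff Y hY0 hloc
  obtain ⟨s₀, hs₀, B₀, hstar₀⟩ := hloc 0 hY0
  set A : E3 ≃ₗᵢ[ℝ] E3 := B₀.toLinearIsometryEquiv rfl with hA
  set Y' : Set E3 := A.symm '' Y with hY'
  -- the conjugated set satisfies the star hypothesis
  have hloc' : ∀ y ∈ Y', ∃ s : ℤ → ℤ, IsHaggSeq s ∧ ∃ B : E3 →ₗᵢ[ℝ] E3,
      ((fun z => z - y) '' Y') ∩ Metric.closedBall 0 (6 * a / 5) =
        B '' (barlowStacking a h s ∩ Metric.closedBall 0 (6 * a / 5)) := by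
    rintro _ ⟨y, hy, rfl⟩
    obtain ⟨s, hs, B, hstar⟩ := hloc y hy
    refine ⟨s, hs, A.symm.toLinearIsometry.comp B, ?_⟩
    rw [hY', star_image_equiv, hstar, Set.image_image]
    rfl
  -- and its star at `0` is standard, so `u, v ∈ Y'`
  have h0' : (0 : E3) ∈ Y' := ⟨0, hY0, map_zero _⟩
  have hstar₀' : ((fun z => z - (0 : E3)) '' Y') ∩ Metric.closedBall 0 (6 * a / 5) =
      barlowStacking a h s₀ ∩ Metric.closedBall 0 (6 * a / 5) := by
    have h1 := star_image_equiv A.symm Y 0 (6 * a / 5)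
    rw [map_zero] at h1
    rw [hY', h1, hstar₀, Set.image_image]
    have h2 : (fun x => A.symm (B₀ x)) = id := by
      funext x
      exact A.symm_apply_apply x
    rw [h2, Set.image_id]
  rw [layeringStar_stacking_inter_closedBall ha hh hw1 hw2 hs₀] at hstar₀'
  have hu : (0 : E3) + 𝐮 ∈ Y' :=
    add_mem_of_star_eq hstar₀' (Or.inl (Or.inl (Or.inr vecU_mem_hex)))
  have hv : (0 : E3) + 𝐯 ∈ Y' :=
    add_mem_of_star_eq hstar₀' (Or.inl (Or.inl (Or.inr vecV_mem_hex)))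
  have hlayer := layer_subset_of_two_neighbours ha hh hw1 hw2 hoff hloc' h0' vecU_mem_hex
    vecV_mem_hex (dist_vecU_vecV ha.le) hu hv
  simp only [zero_add] at hlayer
  -- hence `Y'` is a stacking, and `Y = A '' Y'`
  obtain ⟨s, hs, hYeq⟩ := eq_barlowStacking_of_stars ha hh hw1 hw2 hoff hloc' hlayer
  refine ⟨s, hs, A.toLinearIsometry, ?_⟩
  rw [← hYeq, hY', Set.image_image]
  ext z
  simp

end Summit.AtomisticToContinuum.Crystallization.Theorems.CLayerWitnessLayering

end
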